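import Literature.Analysis.FunctionSpaces.ContDiffHolderLogConvex
import HarnessLib

/-!
# Landau–Kolmogorov interpolation of the sup norms of intermediate derivatives

Analysis/FunctionSpaces support file (everything proved). For a `C^N` map `f` between real normed
spaces whose derivative levels `Mⱼ = ‖Dʲf‖_∞`, `j ≤ N`, are finite, the intermediate levels are
controlled by the extreme ones:

* `toReal_eSupNorm_iteratedFDeriv_succ_le_div_add_mul` — the three-level Landau inequality in
  additive form, `M_{m+1} ≤ 2 (M_m/δ + δ M_{m+2})` for every `δ > 0` (from the tree's
  `eSupNorm_iteratedFDeriv_succ_sq_le`, `M_{m+1}² ≤ 8 M_m M_{m+2}`);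
* `exists_const_toReal_eSupNorm_iteratedFDeriv_le_eps` — **BDSV (A.1) for sup norms**: for every
  order `N` there is a constant `K = K_N ≥ 1` (depending on `N` only, the same for all spaces and
  maps) with `M_s ≤ K (ε^{N-s} M_N + ε^{-s} M_0)` for all `ε > 0`, `0 ≤ s ≤ N` (induction on `N`,
  absorbing the middle level; the recursion is `K_{N+1} = K_N ((4K_N)^N + 6)`);
* `exists_const_norm_iteratedFDeriv_le_of_geometric` — the geometric form used in
  stationary-phase / Nash–Moser bookkeeping: with the same kind of constant, if `M_0 ≤ P` and
  `M_N ≤ P ρ^N` (`ρ > 0`) then `‖Dˢf(y)‖ ≤ K P ρ^s` for all `s ≤ N` (take `ε = ρ⁻¹`); this is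
  (A.3) `[f]_s ≤ C ‖f‖₀^{1-s/N} [f]_N^{s/N}` without fractional powers.

Buckmaster–De Lellis–Székelyhidi–Vicol 2019, App. A, record (A.1) and (A.3) as "elementary" /
"standard interpolation inequalities" for the spatial Hölder norms on `T³`; for periodic functions
the levels are those of the periodic lift, to which these statements apply verbatim (all levels of
a smooth periodic map are finite, `Torus.IsSmooth.memContDiffHolder_holds`). The constants are
existentially quantified BEFORE the spaces and the map (so one constant serves maps with values in
different spaces), which is how they are consumed.

## References

* T. Buckmaster, C. De Lellis, L. Székelyhidi Jr., V. Vicol, *Onsager's conjecture for admissible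
  weak solutions*, CPAM 72 (2019) = arXiv:1701.08678, App. A, (A.1), (A.3). [`BuckmasterEtAl2018`]
* D. Gilbarg, N. Trudinger, *Elliptic PDE of second order* (2001), §6.8, Lemma 6.35.
-/

noncomputable section

open Set
open scoped NNReal ENNReal

namespace Literature.Analysis.FunctionSpaces

universe u v

/-! ## An elementary optimisation step -/

/-- From `a² ≤ 8 P Q` (`a, P, Q ≥ 0`) to `a ≤ 2 (P/δ + δ Q)` for every `δ > 0`
(since `(P/δ + δQ)² ≥ 4PQ`). [folklore] -/
theorem le_two_mul_div_add_mul_of_sq_le {a P Q : ℝ} (ha : 0 ≤ a) (hP : 0 ≤ P) (hQ : 0 ≤ Q)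
    (h : a ^ 2 ≤ 8 * P * Q) {δ : ℝ} (hδ : 0 < δ) : a ≤ 2 * (P / δ + δ * Q) := by
  have h1 : 0 ≤ P / δ + δ * Q := by positivity
  have h2 : (P / δ) * (δ * Q) = P * Q := by field_simp
  have h3 : a ^ 2 ≤ (2 * (P / δ + δ * Q)) ^ 2 := by
    nlinarith [sq_nonneg (P / δ - δ * Q), h2]
  exact (sq_le_sq₀ ha (by positivity)).1 h3

/-! ## Landau's inequality in additive form -/

section Landau

variable {E' Y : Type*} [NormedAddCommGroup E'] [NormedSpace ℝ E'] [NormedAddCommGroup Y]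
  [NormedSpace ℝ Y] {f : E' → Y}

/-- The middle level is finite when the outer ones are: `‖Dᵐ⁺¹f‖_∞ < ∞` if `‖Dᵐf‖_∞, ‖Dᵐ⁺²f‖_∞ < ∞`
(from `‖Dᵐ⁺¹f‖_∞² ≤ 8‖Dᵐf‖_∞‖Dᵐ⁺²f‖_∞`). [folklore] -/
theorem eSupNorm_iteratedFDeriv_succ_ne_top {m : ℕ} (hf : ContDiff ℝ (m + 2 : ℕ) f)
    (h0 : eSupNorm (iteratedFDeriv ℝ m f) ≠ ⊤) (h2 : eSupNorm (iteratedFDeriv ℝ (m + 2) f) ≠ ⊤) :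
    eSupNorm (iteratedFDeriv ℝ (m + 1) f) ≠ ⊤ := by
  intro htop
  have hsq := eSupNorm_iteratedFDeriv_succ_sq_le hf h0 h2
  rw [htop, ENNReal.top_pow two_ne_zero] at hsq
  exact (ENNReal.mul_ne_top (ENNReal.mul_ne_top (by norm_num) h0) h2) (top_le_iff.1 hsq)

/-- **Landau's inequality, additive form.** For a `C^{m+2}` map with finite levels `m` and
`m + 2`: `‖Dᵐ⁺¹f‖_∞ ≤ 2 (‖Dᵐf‖_∞/δ + δ ‖Dᵐ⁺²f‖_∞)` for every `δ > 0` (real values of the finite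
extended sup norms). [folklore] -/
theorem toReal_eSupNorm_iteratedFDeriv_succ_le_div_add_mul {m : ℕ} (hf : ContDiff ℝ (m + 2 : ℕ) f)
    (h0 : eSupNorm (iteratedFDeriv ℝ m f) ≠ ⊤) (h2 : eSupNorm (iteratedFDeriv ℝ (m + 2) f) ≠ ⊤)
    {δ : ℝ} (hδ : 0 < δ) :
    (eSupNorm (iteratedFDeriv ℝ (m + 1) f)).toReal ≤
      2 * ((eSupNorm (iteratedFDeriv ℝ m f)).toReal / δ +
        δ * (eSupNorm (iteratedFDeriv ℝ (m + 2) f)).toReal) := by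
  have hsq := eSupNorm_iteratedFDeriv_succ_sq_le hf h0 h2
  have hfin : 8 * eSupNorm (iteratedFDeriv ℝ m f) * eSupNorm (iteratedFDeriv ℝ (m + 2) f) ≠ ⊤ :=
    ENNReal.mul_ne_top (ENNReal.mul_ne_top (by norm_num) h0) h2
  have hreal := ENNReal.toReal_mono hfin hsq
  rw [ENNReal.toReal_pow, ENNReal.toReal_mul, ENNReal.toReal_mul, ENNReal.toReal_ofNat] at hreal
  exact le_two_mul_div_add_mul_of_sq_le ENNReal.toReal_nonneg ENNReal.toReal_nonneg
    ENNReal.toReal_nonneg hreal hδ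

end Landau

/-! ## BDSV (A.1): `‖Dˢf‖_∞ ≤ K_N (ε^{N-s}‖Dᴺf‖_∞ + ε^{-s}‖f‖_∞)` -/

section Interpolation

/-- The absorption step: if `M_k ≤ K (η M_{k+1} + η^{-k} M_0)` for all `η > 0` (`K ≥ 1`) and
`M_{k+1} ≤ 2 (M_k/δ + δ M_{k+2})` for all `δ > 0`, then
`M_{k+1} ≤ ((4K)^{k+1} + 5) (δ M_{k+2} + δ^{-(k+1)} M_0)` for all `δ > 0` (choose `η = δ/(4K)` and
absorb half of `M_{k+1}`; all quantities finite and nonnegative reals). [folklore] -/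
theorem absorb_middle_level {M0 Mk Mk1 Mk2 K : ℝ} {k : ℕ} (hK : 1 ≤ K) (hM0 : 0 ≤ M0)
    (hMk2 : 0 ≤ Mk2)
    (hk : ∀ η : ℝ, 0 < η → Mk ≤ K * (η * Mk1 + (η ^ k)⁻¹ * M0))
    (hL : ∀ δ : ℝ, 0 < δ → Mk1 ≤ 2 * (Mk / δ + δ * Mk2)) {δ : ℝ} (hδ : 0 < δ) :
    Mk1 ≤ ((4 * K) ^ (k + 1) + 5) * (δ * Mk2 + (δ ^ (k + 1))⁻¹ * M0) := by
  have hK0 : 0 < K := by linarith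
  set η : ℝ := δ / (4 * K) with hη
  have hη0 : 0 < η := by positivity
  have h1 := hk η hη0
  have h2 := hL δ hδ
  have hηk : (η ^ k)⁻¹ = (4 * K) ^ k * (δ ^ k)⁻¹ := by
    rw [hη, div_pow, inv_div, mul_pow, div_eq_mul_inv]
  -- `Mk/δ ≤ (K η/δ) Mk1 + (K/δ) η^{-k} M0 = Mk1/4 + K (4K)^k δ^{-(k+1)} M0`
  have h3 : Mk / δ ≤ Mk1 / 4 + K * (4 * K) ^ k * (δ ^ (k + 1))⁻¹ * M0 := by
    have := div_le_div_of_nonneg_right h1 hδ.le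
    refine this.trans (le_of_eq ?_)
    rw [hηk, hη]
    field_simp
    ring
  -- absorb
  have h4 : Mk1 ≤ Mk1 / 2 + 2 * K * (4 * K) ^ k * (δ ^ (k + 1))⁻¹ * M0 + 2 * δ * Mk2 := by
    nlinarith [h2, h3]
  have h5 : Mk1 ≤ 4 * K * (4 * K) ^ k * (δ ^ (k + 1))⁻¹ * M0 + 4 * δ * Mk2 := by linarith
  have h6 : 4 * K * (4 * K) ^ k = (4 * K) ^ (k + 1) := by ring
  rw [h6] at h5
  have hA : 0 ≤ (4 * K) ^ (k + 1) := by positivity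
  have hB : 0 ≤ (δ ^ (k + 1))⁻¹ * M0 := by positivity
  have hC : 0 ≤ δ * Mk2 := by positivity
  nlinarith [h5, hA, hB, hC, mul_nonneg hA hC, mul_nonneg hA hB]

/-- **Sup-norm interpolation, BDSV (A.1).** For every order `N` there is a constant `K ≥ 1`
(depending on `N` only) such that for every `C^N` map `f` between real normed spaces all of whose
levels `‖Dʲf‖_∞`, `j ≤ N`, are finite, every `ε > 0` and every `s ≤ N`:
`‖Dˢf‖_∞ ≤ K (ε^{N-s} ‖Dᴺf‖_∞ + ε^{-s} ‖D⁰f‖_∞)` (`‖D⁰f‖_∞ = ‖f‖_∞`). Proof by induction on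
`N`: Landau's inequality for the levels `N-1, N, N+1` and the inductive bound for level `N-1`
give, after absorbing the middle level, the case `s = N` of order `N+1`, which is fed back into
the inductive bounds; the constants follow `K_{N+1} = K_N((4K_N)^N + 6)`.
[cite: BuckmasterEtAl2018, App. A (A.1)] -/
theorem exists_const_toReal_eSupNorm_iteratedFDeriv_le_eps (N : ℕ) :
    ∃ K : ℝ, 1 ≤ K ∧ ∀ {E' : Type u} {Y : Type v} [NormedAddCommGroup E'] [NormedSpace ℝ E']
      [NormedAddCommGroup Y] [NormedSpace ℝ Y] {f : E' → Y}, ContDiff ℝ N f →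
      (∀ j ≤ N, eSupNorm (iteratedFDeriv ℝ j f) ≠ ⊤) → ∀ {ε : ℝ}, 0 < ε → ∀ {s : ℕ}, s ≤ N →
        (eSupNorm (iteratedFDeriv ℝ s f)).toReal ≤
          K * (ε ^ (N - s) * (eSupNorm (iteratedFDeriv ℝ N f)).toReal +
            (ε ^ s)⁻¹ * (eSupNorm (iteratedFDeriv ℝ 0 f)).toReal) := by
  induction N with
  | zero =>
      refine ⟨1, le_rfl, ?_⟩
      intro E' Y _ _ _ _ f hf hfin ε hε s hs
      obtain rfl : s = 0 := Nat.le_zero.1 hs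
      simp only [Nat.sub_zero, pow_zero, one_mul, inv_one]
      linarith [(ENNReal.toReal_nonneg : 0 ≤ (eSupNorm (iteratedFDeriv ℝ 0 f)).toReal)]
  | succ n ih =>
      obtain ⟨K, hK, hKb⟩ := ih
      have hK0 : 0 ≤ K := by linarith
      -- the new constant
      refine ⟨K * ((4 * K) ^ n + 6), ?_, ?_⟩
      · have h4 : (1 : ℝ) ≤ (4 * K) ^ n := one_le_pow₀ (by linarith)
        nlinarith
      intro E' Y _ _ _ _ f hf hfin ε hε s hs
      set M : ℕ → ℝ := fun j => (eSupNorm (iteratedFDeriv ℝ j f)).toReal with hM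
      have hM0 : ∀ j, 0 ≤ M j := fun j => ENNReal.toReal_nonneg
      have hKn : (1 : ℝ) ≤ K * ((4 * K) ^ n + 6) := by
        have h4 : (1 : ℝ) ≤ (4 * K) ^ n := one_le_pow₀ (by linarith)
        nlinarith
      -- the top level `s = n + 1` is trivial
      rcases hs.lt_or_eq with hlt | rfl
      swap
      · simp only [Nat.sub_self, pow_zero, one_mul]
        have hB : 0 ≤ (ε ^ (n + 1))⁻¹ * M 0 := by positivity
        change M (n + 1) ≤ K * ((4 * K) ^ n + 6) * (M (n + 1) + (ε ^ (n + 1))⁻¹ * M 0)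
        nlinarith [hM0 (n + 1)]
      have hsn : s ≤ n := Nat.lt_succ_iff.1 hlt
      have hf' : ContDiff ℝ (n : ℕ) f := hf.of_le (by exact_mod_cast Nat.le_succ _)
      have hfin' : ∀ j ≤ n, eSupNorm (iteratedFDeriv ℝ j f) ≠ ⊤ :=
        fun j hj => hfin j (hj.trans (Nat.le_succ _))
      have ih' : ∀ {ε : ℝ}, 0 < ε → ∀ {s : ℕ}, s ≤ n →
          M s ≤ K * (ε ^ (n - s) * M n + (ε ^ s)⁻¹ * M 0) :=
        fun {ε} hε {s} hs => hKb hf' hfin' hε hs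
      cases n with
      | zero =>
          -- order one, `s = 0`
          obtain rfl : s = 0 := Nat.le_zero.1 hsn
          simp only [Nat.zero_add, Nat.sub_zero, pow_one, pow_zero, inv_one, one_mul]
          change M 0 ≤ K * ((4 * K) ^ 0 + 6) * (ε * M 1 + M 0)
          have h1 : 0 ≤ ε * M 1 := by positivity
          rw [pow_zero] at hKn ⊢
          nlinarith [hM0 0]
      | succ k =>
          -- order `k + 2`, inductive bounds at order `k + 1`
          -- the bound for the level `k + 1` at order `k + 2`
          have hmid : ∀ δ : ℝ, 0 < δ →
              M (k + 1) ≤ ((4 * K) ^ (k + 1) + 5) * (δ * M (k + 2) + (δ ^ (k + 1))⁻¹ * M 0) := by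
            intro δ hδ
            refine absorb_middle_level (Mk := M k) hK (hM0 0) (hM0 (k + 2)) (fun η hη => ?_)
              (fun δ' hδ' => ?_) hδ
            · have h := ih' hη (s := k) (Nat.le_succ k)
              simpa [Nat.add_sub_cancel_left] using h
            · have hf2 : ContDiff ℝ (k + 2 : ℕ) f := hf
              exact toReal_eSupNorm_iteratedFDeriv_succ_le_div_add_mul hf2
                (hfin k (by omega)) (hfin (k + 2) le_rfl) hδ'
          -- feed it back
          have h1 := ih' hε hsn
          have h2 := hmid ε hε
          set K' : ℝ := (4 * K) ^ (k + 1) + 5 with hK'def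
          have hK'0 : 0 ≤ K' := by positivity
          have hεpow : ε ^ (k + 1 - s) * (ε ^ (k + 1))⁻¹ = (ε ^ s)⁻¹ := by
            obtain ⟨t, ht⟩ := Nat.exists_eq_add_of_le hsn
            have hts : k + 1 - s = t := by omega
            rw [hts, ht, pow_add, mul_inv, mul_comm ((ε ^ s)⁻¹) _, ← mul_assoc,
              mul_inv_cancel₀ (pow_ne_zero _ hε.ne'), one_mul]
          have hεpow' : ε ^ (k + 1 - s) * ε = ε ^ (k + 1 + 1 - s) := by
            rw [← pow_succ]
            congr 1
            omega
          -- `M s ≤ K (ε^{k+1-s} M_{k+1} + ε^{-s} M_0)` and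
          -- `M_{k+1} ≤ K' (ε M_{k+2} + ε^{-(k+1)} M_0)`
          have h3 : ε ^ (k + 1 - s) * M (k + 1) ≤
              K' * (ε ^ (k + 1 + 1 - s) * M (k + 2) + (ε ^ s)⁻¹ * M 0) := by
            have := mul_le_mul_of_nonneg_left h2 (pow_nonneg hε.le (k + 1 - s))
            refine this.trans (le_of_eq ?_)
            rw [← hεpow, ← hεpow']
            ring
          have hlk : K * ((4 * K) ^ (k + 1) + 6) = K * (K' + 1) := by
            rw [hK'def]; ring
          rw [hlk]
          have hX : 0 ≤ ε ^ (k + 1 + 1 - s) * M (k + 2) + (ε ^ s)⁻¹ * M 0 := by positivity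
          calc M s ≤ K * (ε ^ (k + 1 - s) * M (k + 1) + (ε ^ s)⁻¹ * M 0) := h1
            _ ≤ K * (K' * (ε ^ (k + 1 + 1 - s) * M (k + 2) + (ε ^ s)⁻¹ * M 0) + (ε ^ s)⁻¹ * M 0) := by
                gcongr
            _ ≤ K * (K' + 1) * (ε ^ (k + 1 + 1 - s) * M (k + 2) + (ε ^ s)⁻¹ * M 0) := by
                have hB : 0 ≤ (ε ^ s)⁻¹ * M 0 := by positivity
                have hA : 0 ≤ ε ^ (k + 1 + 1 - s) * M (k + 2) := by positivity
                nlinarith [mul_nonneg hK0 hA]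

/-- **Geometric form of the interpolation inequality** (BDSV (A.3) without fractional powers).
For every order `N` there is a constant `K ≥ 1` (depending on `N` only) such that: if `f` is
`C^N` with finite levels, `‖f‖_∞ ≤ P` and `‖Dᴺf‖_∞ ≤ P ρᴺ` for some `ρ > 0`, then
`‖Dˢf(y)‖ ≤ K P ρˢ` for every `s ≤ N` and every point `y` (the case `ε = ρ⁻¹` of (A.1), with
`K = 2K_N`). [cite: BuckmasterEtAl2018, App. A (A.3)] -/
theorem exists_const_norm_iteratedFDeriv_le_of_geometric (N : ℕ) :
    ∃ K : ℝ, 1 ≤ K ∧ ∀ {E' : Type u} {Y : Type v} [NormedAddCommGroup E'] [NormedSpace ℝ E']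
      [NormedAddCommGroup Y] [NormedSpace ℝ Y] {f : E' → Y}, ContDiff ℝ N f →
      (∀ j ≤ N, eSupNorm (iteratedFDeriv ℝ j f) ≠ ⊤) → ∀ {P ρ : ℝ}, 0 < ρ →
      (eSupNorm (iteratedFDeriv ℝ 0 f)).toReal ≤ P →
      (eSupNorm (iteratedFDeriv ℝ N f)).toReal ≤ P * ρ ^ N → ∀ {s : ℕ}, s ≤ N → ∀ y : E',
        ‖iteratedFDeriv ℝ s f y‖ ≤ K * P * ρ ^ s := by
  obtain ⟨K, hK, hKb⟩ := exists_const_toReal_eSupNorm_iteratedFDeriv_le_eps.{u, v} N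
  refine ⟨2 * K, by linarith, ?_⟩
  intro E' Y _ _ _ _ f hf hfin P ρ hρ h0 hN s hs y
  have hP : 0 ≤ P := le_trans ENNReal.toReal_nonneg h0
  have hK0 : 0 ≤ K := by linarith
  have h1 := hKb hf hfin (inv_pos.2 hρ) hs
  have hρs : (ρ⁻¹ ^ s)⁻¹ = ρ ^ s := by rw [inv_pow, inv_inv]
  have hρN : ρ⁻¹ ^ (N - s) * (P * ρ ^ N) = P * ρ ^ s := by
    obtain ⟨t, rfl⟩ := Nat.exists_eq_add_of_le hs
    rw [Nat.add_sub_cancel_left, pow_add, inv_pow]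
    field_simp
  calc ‖iteratedFDeriv ℝ s f y‖ ≤ (eSupNorm (iteratedFDeriv ℝ s f)).toReal :=
        norm_le_toReal_eSupNorm (hfin s hs) y
    _ ≤ K * (ρ⁻¹ ^ (N - s) * (eSupNorm (iteratedFDeriv ℝ N f)).toReal +
          (ρ⁻¹ ^ s)⁻¹ * (eSupNorm (iteratedFDeriv ℝ 0 f)).toReal) := h1
    _ ≤ K * (ρ⁻¹ ^ (N - s) * (P * ρ ^ N) + (ρ⁻¹ ^ s)⁻¹ * P) := by
        gcongr
    _ = 2 * K * P * ρ ^ s := by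
        rw [hρN, hρs]; ring

end Interpolation

end Literature.Analysis.FunctionSpaces
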